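import Summits.QuantumFields.BalabanUV.Beta.D1BFx.PackedColumnBlockTotalMass

/-!
# `BalabanUV.Beta.D1BFx.PackedColumnBlockIndexedMass` — road «BF-x» for binder row D1, slot (K), the (J1) defect words' CONTACT FAMILIES in the
# (M-b) currency: **«FACE-PACK» — THE BLOCK-TOTAL LETTER AND THE PACKED-VERTEX ROW OF A BLOCK-INDEXED SLOT FAMILY
# `S′ κ (n•y′ + b) = c κ (n•y′ + b) • F κ y′` (ONE TABLE PER COARSE BLOCK, A SCALAR WEIGHT PER SLOT) FROM THE PRODUCT LETTER
# «(block-ℓ¹ norm of the weights) × (mass of the block table) ≤ n⁴·m̄», AND THE MASS OF A FINITE SIGNED COMBINATION OF TABLES RECENTRED**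
# (the shape of the OWNER's face family `S^face α x := |box|⁻¹·ζ_S(e_{(α,x)})(blk x)·Σ_{faces(blk x)} (±)•S κ′ u` of `J1-DEFECT-WORDS` v0.1 (ii);
# definition-agnostic — the structure enters as a DISPLAYED pointwise hypothesis; UNCONDITIONAL; [folklore] `ℓ¹` bookkeeping)

HONEST DEPENDENCY (cell records, verbatim): «continuum YM on T⁴ ⇐ BetaPertH ∧ nine spine estimates (0/9 proved); BetaPertH ⇐ (D1) ∧ (D4) ∧
CAP+tail; G-an2-4 gates asym, D1 and NE2/3/4.»  HONEST FRAMING (cell contract, verbatim): «discharging `BetaPertH` makes Bałaban's UV stability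
UNCONDITIONAL — a real constructive-QFT result; it is NOT the continuum limit and NOT the Clay problem.»  THIS MODULE DISCHARGES NOTHING of the
wall: [folklore] `ℓ¹` bookkeeping BY NAME over this lineage's `PackedColumnBlockTotalMass` (§1 `l1_toSite_le_of_mem_box`, §2
`mass_blk_vertexOfK_G₀_le_of_blockTotal`), d1-leaf-04's generic mass lemmas (`RestJetBlockMass.stencil_mass_recentre`, `GhostWordJetMass.mass_smul_le ∕
mass_finset_sum_le`) and the block index ∕ offset of a site (`AveragingContours.blk_add_off ∕ off_mem_box`).  Every letter is a DISPLAYED hypothesis on an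
ARBITRARY family; the block-indexed structure `S′ κ (n•y′ + b) = c κ (n•y′ + b) • F κ y′` is itself a DISPLAYED pointwise hypothesis (no definition of a face
family is made or used here); nothing about Bałaban's (or an1's ∕ an3's) tables, about `ζ_S` or about the comb's `colG` law is asserted.  No definition, no
`def … : Prop`, nothing cited, 0 sorry.  NO (1.22) unit row is proved here.  0 root-level binders of row D1 discharged (hW ∕ hR-sockets ∕ hSX-socket ∕ D1Tel ∕
D1Rep = 0); (J1) = ONE OPEN ROW `hC₁ := Δ_n`; [W] OPEN; (K) NOT closed; NOT D1, NOT `BetaPertH`, NOT continuum, NOT Clay.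

ABSOLUTE RULE (cell charter, verbatim): «No internally-minted statement may enter as a cited fact. Every hypothesis is either kernel-proved in
this package or a verbatim quotation of a PUBLISHED theorem with page reference. The manuscript(s) under audit are NOT citable for their own
disputed steps — they are the thing under adjudication; programme-internal (2001/route/tribunal) claims are never citable.»

WHY (road OWNER d1-p2 g22, `J1-DEFECT-WORDS.md` v0.1 §6 W-5 «rows (R-c1)(R-c2) — lanes (… gan24-leaf-05 packed currency)» and ADDENDUM (ii): the slot adjunction at
leaf-03's symmetric corrector reads `vertexOfK (Ψ̂ K Ψ̂ᵀ) n S = vertexOfK K n S + vertexOfK K n S^face` with the CONTACT family `S^face α x :=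
|box|⁻¹·ζ_S(e_{(α,x)})(blk x)·Σ_{(κ′,u) ∈ faces(blk x)} (±1)•S κ′ u`; «its (M-b) packed row is the road's first concrete pricing target»; N-g22-1: the weights are
O(1) (`max c → 1∕(2D)`) while their block-ℓ¹ norm is `|box|⁻¹·Σ_{j∈B} |lam04 j| ≈ (D∕4)·n`).  Such a family is BLOCK-INDEXED — on the block `y′` every slot
carries the SAME table `F(y′)` (the signed face sum) times a scalar slot weight — and for a block-indexed family the (M-b) input letter `hSB` of
`PackedColumnBlockTotalMass` §2 FACTORISES: `Σ_{b ∈ box} M_{n•y′+b}(c • F) ≤ (Σ_{b ∈ box} |c (n•y′ + b)|)·e^{2σ·4n}·M_{n•y′}(F)` (the scalar comes out; the table's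
mass is recentred from the block base at cost `e^{2σ|b|₁} ≤ e^{κ′∕2}` for `σ ≤ κ′∕(16n)`).  So the ONE letter the count must supply per block is the PRODUCT
«(block-ℓ¹ norm of the weights) × (base-centred mass of the block table) ≤ n⁴·m̄» (N-g22-1: `≈ n × (8 faces × n³ slots × O(1))`, a k-free `m̄`), and §2 of
`PackedColumnBlockTotalMass` prices the packed vertex of the contact family at the road's own weights with POWER `n⁰`, as for the raw family; the block table's
own mass comes from the raw tables' masses by the finite-combination bookkeeping of §4 (face totals, recentred to the block base).  Nothing here decides the
size of `hC₁`: both counts (the weights' block-ℓ¹ law = an1's `Σ_j |lam04 j|`; the face totals of the raw masses) are displayed letters.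

CONTENT (all [folklore]).  §1 GENERIC (any `D`, any fibre): `mass_smul_recentre_le`, **`blockTotal_le_of_blockIndexed`** (the factorised block-total letter),
`mass_blockIndexed_slot_summable` (any slot, via `u = n•blk u + off u`).  §2 `d = 3`, any in-block root `r`: **`mass_blk_vertexOfK_G₀_le_of_blockIndexed`** — for
`0 ≤ σ ≤ κ′∕(16n)`, `S′ κ (n•y′ + b) = c κ (n•y′ + b) • F κ y′` and the PRODUCT letter `(Σ_{b ∈ box 4 n} |c κ (n•y′ + b)|)·M_{n•y′}(blk (F κ y′) j k) ≤ n⁴·m̄ j k`, every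
block of `vertexOfK (G₀^{bm} r) n S′ μ y` has centred weighted mass at `n•y`, rate `σ`, `≤ 4·C_{G₀}·e^{κ′∕2}·Zl 4 (κ′∕8)·(e^{κ′∕2}·m̄ j k)` (POWER `n⁰`);
**`…_split`** — the same from the two counts displayed separately (`Σ_b |c| ≤ n·cW`, block-table mass `≤ n³·m̄F`).  §3 the consumer shapes **`…_at (N) [NeZero N]`** and
**`hP_of_blockIndexed_scales`** (on `Lc^k`, `k ≥ 1`, all four blocks, in `PackedRoadRowsMassFlat.jet_letters_mass_flat`'s `hPs ∕ hPm` shape without the guard `j ≠ k′`).  §4 GENERIC: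
**`mass_finset_sum_smul_recentre_le`** ∕ **`mass_blk_finset_sum_smul_recentre_le`** — a finite signed combination `Σ_{s ∈ Φ} a s • K s` with `(q s)`-centred masses `≤ ρ s`,
centres within `|q s − c|₁ ≤ R`, has `c`-centred mass `≤ e^{2σR}·Σ_{s ∈ Φ} |a s|·ρ s` (the face sum's mass from the FACE TOTAL of the raw tables' letters).
NOT HERE (honest): the face family and its [S] sockets (W-3′, OWNER ∕ leaf-03 over `SymCorrector*`); the weights' block-ℓ¹ law (an1's `Σ_j |lam04 j|`, N-g22-1) and
the face totals (the table author); the leg words (W-leg); any (1.22) row; the size of `hC₁`.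
`κ′ = kappa163 4 ∕ 4`, `C_{G₀} = (MG163 4·periodConst (kappa163 4) 3)·(1 + 8(1 + e^{κ′}))·e^{κ′}`, `n = m + 1`.
Unit `b2b-balaban-gan24-formalise-leaf-05` (gen 58), G-an2-4 swarm leaf prover 05, road «BF-x» supplier; INTENT «FACE-PACK» (journal).
-/

noncomputable section

open Finset
open scoped BigOperators
open Literature.MathematicalPhysics.QuantumFieldTheory.Balaban1983to89
open Literature.MathematicalPhysics.QuantumFieldTheory.Balaban1983to89.Beta
open B12Sec2to5 (l1 l1_nonneg)
open B5Hk163Strip (kappa163 kappa163_pos)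
open B5Hk163Decay (MG163)
open B4TorusKernel (periodConst)
open ExpKernelCalculus (Site MKer Zl l1_sub_symm)
open AffineAveraging (box toSite)
open AveragingContours (off off_mem_box blk_add_off)
open OneStepResolventKernel (Fib)
open OneStepKernelFamily (KInvStep vertexOfK)
open Summit.QuantumFields.BalabanUV.Beta.AxialDressingRooted (coDressKBmAt)
open Summit.QuantumFields.BalabanUV.Beta.D1BFx.PackedKernelSplit (blk)
open Summit.QuantumFields.BalabanUV.Beta.D1BFx.RestJetBlockMass (stencil_mass_recentre)
open Summit.QuantumFields.BalabanUV.Beta.D1BFx.GhostWordJetMass (mass_smul_le mass_finset_sum_le)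
open Summit.QuantumFields.BalabanUV.Beta.D1BFx.PackedColumnBlockTotalMass (l1_toSite_le_of_mem_box mass_blk_vertexOfK_G₀_le_of_blockTotal)

namespace Summit.QuantumFields.BalabanUV.Beta.D1BFx.PackedColumnBlockIndexedMass

/-! ## §1 Generic: the block-total letter of a block-indexed slot family factorises -/

section Generic
variable {D : ℕ} {F : Type*} [Fintype F]

/-- [folklore] **ONE BLOCK-INDEXED SLOT, RECENTRED**: if `T u = c u • Fy` and `Fy` has summable `y₀`-centred `σ`-weighted mass `M` (`0 ≤ σ`), then `T u` has summable
`u`-centred `σ`-weighted mass `≤ |c u|·(M·e^{2σ|y₀ − u|₁})` (`mass_smul_le` + `stencil_mass_recentre`). -/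
theorem mass_smul_recentre_le {T : Site D → MKer D F} {c : Site D → ℝ} {Fy : MKer D F} {σ : ℝ} (hσ : 0 ≤ σ) (y₀ u : Site D)
    (hT : T u = c u • Fy) (hFs : Summable fun p : Site D × Site D => ∑ a, ∑ b, |Fy p.1 p.2 a b| * Real.exp (σ * (l1 (p.1 - y₀) + l1 (p.2 - y₀)))) :
    (Summable fun p : Site D × Site D => ∑ a, ∑ b, |T u p.1 p.2 a b| * Real.exp (σ * (l1 (p.1 - u) + l1 (p.2 - u)))) ∧
      ∑' p : Site D × Site D, ∑ a, ∑ b, |T u p.1 p.2 a b| * Real.exp (σ * (l1 (p.1 - u) + l1 (p.2 - u)))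
        ≤ |c u| * ((∑' p : Site D × Site D, ∑ a, ∑ b, |Fy p.1 p.2 a b| * Real.exp (σ * (l1 (p.1 - y₀) + l1 (p.2 - y₀))))
          * Real.exp (2 * σ * l1 (y₀ - u))) := by
  obtain ⟨hs, hb⟩ := stencil_mass_recentre (K := Fy) hσ y₀ u hFs le_rfl  -- recentre the block table from `y₀` to `u`
  rw [hT]
  exact mass_smul_le (W := fun p : Site D × Site D => Real.exp (σ * (l1 (p.1 - u) + l1 (p.2 - u)))) hs hb

/-- [folklore] **THE BLOCK-TOTAL LETTER OF A BLOCK-INDEXED SLOT FAMILY FACTORISES** (GENERIC; any `D`, block side `n`, any fibre): if `T (n•y′ + b) = c (n•y′ + b) • Fy`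
on the block `y′` and `Fy` has summable `n•y′`-centred `σ`-mass (`0 ≤ σ`), every `T (n•y′ + b)` has summable `u`-centred `σ`-mass and
`Σ_{b ∈ box D n} (u-centred mass of T (n•y′ + b)) ≤ (Σ_{b ∈ box D n} |c (n•y′ + b)|)·e^{2σ·D·n}·(n•y′-centred mass of Fy)` (recentring `e^{2σ|b|₁} ≤ e^{2σ·D·n}`). -/
theorem blockTotal_le_of_blockIndexed {n : ℕ} {T : Site D → MKer D F} {c : Site D → ℝ} {Fy : MKer D F} {σ : ℝ} (hσ : 0 ≤ σ) (y' : Site D)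
    (hT : ∀ b ∈ box D n, T ((n : ℤ) • y' + toSite b) = c ((n : ℤ) • y' + toSite b) • Fy)
    (hFs : Summable fun p : Site D × Site D => ∑ a, ∑ b, |Fy p.1 p.2 a b|
      * Real.exp (σ * (l1 (p.1 - (n : ℤ) • y') + l1 (p.2 - (n : ℤ) • y')))) :
    (∀ b ∈ box D n, Summable fun p : Site D × Site D => ∑ a, ∑ b', |T ((n : ℤ) • y' + toSite b) p.1 p.2 a b'|
        * Real.exp (σ * (l1 (p.1 - ((n : ℤ) • y' + toSite b)) + l1 (p.2 - ((n : ℤ) • y' + toSite b))))) ∧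
      ∑ b ∈ box D n, (∑' p : Site D × Site D, ∑ a, ∑ b', |T ((n : ℤ) • y' + toSite b) p.1 p.2 a b'|
          * Real.exp (σ * (l1 (p.1 - ((n : ℤ) • y' + toSite b)) + l1 (p.2 - ((n : ℤ) • y' + toSite b)))))
        ≤ (∑ b ∈ box D n, |c ((n : ℤ) • y' + toSite b)|) * Real.exp (2 * σ * ((D : ℝ) * (n : ℝ)))
          * (∑' p : Site D × Site D, ∑ a, ∑ b, |Fy p.1 p.2 a b| * Real.exp (σ * (l1 (p.1 - (n : ℤ) • y') + l1 (p.2 - (n : ℤ) • y')))) := by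
  set M : ℝ := ∑' p : Site D × Site D, ∑ a, ∑ b, |Fy p.1 p.2 a b|
    * Real.exp (σ * (l1 (p.1 - (n : ℤ) • y') + l1 (p.2 - (n : ℤ) • y'))) with hM
  have hM0 : 0 ≤ M := tsum_nonneg fun p => Finset.sum_nonneg fun a _ => Finset.sum_nonneg fun b _ => by positivity
  -- per slot of the block
  have hslot : ∀ b ∈ box D n,
      (Summable fun p : Site D × Site D => ∑ a, ∑ b', |T ((n : ℤ) • y' + toSite b) p.1 p.2 a b'|
        * Real.exp (σ * (l1 (p.1 - ((n : ℤ) • y' + toSite b)) + l1 (p.2 - ((n : ℤ) • y' + toSite b))))) ∧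
      ∑' p : Site D × Site D, ∑ a, ∑ b', |T ((n : ℤ) • y' + toSite b) p.1 p.2 a b'|
          * Real.exp (σ * (l1 (p.1 - ((n : ℤ) • y' + toSite b)) + l1 (p.2 - ((n : ℤ) • y' + toSite b))))
        ≤ |c ((n : ℤ) • y' + toSite b)| * Real.exp (2 * σ * ((D : ℝ) * (n : ℝ))) * M := by
    intro b hb
    obtain ⟨hs, hle⟩ := mass_smul_recentre_le (T := T) (c := c) (Fy := Fy) hσ ((n : ℤ) • y') ((n : ℤ) • y' + toSite b) (hT b hb) hFs
    refine ⟨hs, hle.trans ?_⟩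
    -- the in-block offset `|n•y′ − (n•y′ + b)|₁ = |b|₁ ≤ D·n`
    have hoff : l1 ((n : ℤ) • y' - ((n : ℤ) • y' + toSite b)) ≤ (D : ℝ) * (n : ℝ) := by
      rw [l1_sub_symm, add_sub_cancel_left]
      exact l1_toSite_le_of_mem_box hb
    have hexp : Real.exp (2 * σ * l1 ((n : ℤ) • y' - ((n : ℤ) • y' + toSite b))) ≤ Real.exp (2 * σ * ((D : ℝ) * (n : ℝ))) :=
      Real.exp_le_exp.2 (by nlinarith [hoff, hσ, l1_nonneg ((n : ℤ) • y' - ((n : ℤ) • y' + toSite b))])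
    rw [← hM]
    calc |c ((n : ℤ) • y' + toSite b)| * (M * Real.exp (2 * σ * l1 ((n : ℤ) • y' - ((n : ℤ) • y' + toSite b))))
        ≤ |c ((n : ℤ) • y' + toSite b)| * (M * Real.exp (2 * σ * ((D : ℝ) * (n : ℝ)))) :=
          mul_le_mul_of_nonneg_left (mul_le_mul_of_nonneg_left hexp hM0) (abs_nonneg _)
      _ = |c ((n : ℤ) • y' + toSite b)| * Real.exp (2 * σ * ((D : ℝ) * (n : ℝ))) * M := by ring
  refine ⟨fun b hb => (hslot b hb).1, ?_⟩
  calc ∑ b ∈ box D n, (∑' p : Site D × Site D, ∑ a, ∑ b', |T ((n : ℤ) • y' + toSite b) p.1 p.2 a b'|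
          * Real.exp (σ * (l1 (p.1 - ((n : ℤ) • y' + toSite b)) + l1 (p.2 - ((n : ℤ) • y' + toSite b)))))
      ≤ ∑ b ∈ box D n, |c ((n : ℤ) • y' + toSite b)| * Real.exp (2 * σ * ((D : ℝ) * (n : ℝ))) * M :=
        Finset.sum_le_sum fun b hb => (hslot b hb).2
    _ = (∑ b ∈ box D n, |c ((n : ℤ) • y' + toSite b)|) * Real.exp (2 * σ * ((D : ℝ) * (n : ℝ))) * M := by
        rw [Finset.sum_mul, Finset.sum_mul]

/-- [folklore] **ANY SLOT OF A BLOCK-INDEXED FAMILY** (block side `n ≥ 1`): with `u = n•blk u + off u` (`AveragingContours.blk_add_off`), a family that is block-indexed on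
every block, `T (n•y′ + b) = c (n•y′ + b) • F y′`, with every block table of summable base-centred `σ`-mass, has at every slot `u` a summable `u`-centred
`σ`-weighted mass (the per-slot summability input `hSs` of `PackedColumnBlockTotalMass` §2). -/
theorem mass_blockIndexed_slot_summable {n : ℕ} (hn : 1 ≤ n) {T : Site D → MKer D F} {c : Site D → ℝ} {Fb : Site D → MKer D F} {σ : ℝ}
    (hσ : 0 ≤ σ) (hT : ∀ (y' : Site D), ∀ b ∈ box D n, T ((n : ℤ) • y' + toSite b) = c ((n : ℤ) • y' + toSite b) • Fb y')
    (hFs : ∀ y' : Site D, Summable fun p : Site D × Site D => ∑ a, ∑ b, |Fb y' p.1 p.2 a b|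
      * Real.exp (σ * (l1 (p.1 - (n : ℤ) • y') + l1 (p.2 - (n : ℤ) • y')))) (u : Site D) :
    Summable fun p : Site D × Site D => ∑ a, ∑ b, |T u p.1 p.2 a b| * Real.exp (σ * (l1 (p.1 - u) + l1 (p.2 - u))) := by
  have hu : (n : ℤ) • AveragingContours.blk n u + toSite (off n u) = u := blk_add_off hn u
  have h := (blockTotal_le_of_blockIndexed (T := T) (c := c) hσ (AveragingContours.blk n u) (hT _) (hFs _)).1 (off n u) (off_mem_box hn u)
  rwa [hu] at h

end Generic

/-- [our object] The blocks of a scalar multiple of a packed table (definitional). -/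
theorem blk_smul' (a : ℝ) (K : MKer 4 (Fib 3)) (j k : Bool) : blk (a • K) j k = a • blk K j k := rfl
/-! ## §2 `d = 3`: the (M-b) packed-vertex row of a block-indexed contact family at the road's gauged packed weights (any in-block root) -/

section Packed
variable (m : ℕ) {r : Fin (3 + 1) → ℕ} (hr : r ∈ box (3 + 1) (m + 1))
include hr

/-- [folklore] **«FACE-PACK»: THE (M-b) PACKED-VERTEX ROW OF A BLOCK-INDEXED CONTACT FAMILY AT THE ROAD's `Π_bm`-GAUGED WEIGHTS, ANY IN-BLOCK ROOT**
(UNCONDITIONAL): for `0 ≤ σ ≤ κ′∕(16n)`, `S′ κ (n•y′ + b) = c κ (n•y′ + b) • F κ y′` (every `κ`, coarse block `y′`, `b ∈ box 4 n` — ONE table per block times a scalar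
slot weight, the shape of the OWNER's face family), block tables with blocks of summable base-centred `σ`-masses, and the PRODUCT letter
`(Σ_{b ∈ box 4 n} |c κ (n•y′ + b)|)·(Σ'|blk (F κ y′) j k|·e^{σ(…)}) ≤ n⁴·m̄ j k`: every block of `vertexOfK (G₀^{bm} r) n S′ μ y` has centred weighted mass at `n•y`,
rate `σ`, summable and `≤ 4·C_{G₀}·e^{κ′∕2}·Zl 4 (κ′∕8)·(e^{κ′∕2}·m̄ j k)` (`mass_blk_vertexOfK_G₀_le_of_blockTotal` on §1's factorised letter; recentring
`e^{2σ·4n} ≤ e^{κ′∕2}`).  POWER `n⁰` (N-g22-1: block-ℓ¹ of the weights `≈ n`, face table `≈ 8·n³` unit masses ⇒ product `≍ n⁴`, k-free `m̄`). -/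
theorem mass_blk_vertexOfK_G₀_le_of_blockIndexed {S' : Fin (3 + 1) → (Fin (3 + 1) → ℤ) → MKer 4 (Fib 3)}
    {c : Fin (3 + 1) → (Fin (3 + 1) → ℤ) → ℝ} {F : Fin (3 + 1) → (Fin (3 + 1) → ℤ) → MKer 4 (Fib 3)} {σ : ℝ} {mS : Bool → Bool → ℝ}
    (hσ0 : 0 ≤ σ) (hσ : σ ≤ kappa163 4 / 4 / (16 * ((m + 1 : ℕ) : ℝ)))
    (hS' : ∀ (κ : Fin (3 + 1)) (y' : Fin (3 + 1) → ℤ), ∀ b ∈ box (3 + 1) (m + 1),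
      S' κ (((m + 1 : ℕ) : ℤ) • y' + toSite b) = c κ (((m + 1 : ℕ) : ℤ) • y' + toSite b) • F κ y')
    (hFs : ∀ (κ : Fin (3 + 1)) (y' : Fin (3 + 1) → ℤ) (j k : Bool), Summable fun p : Site 4 × Site 4 =>
      ∑ g, ∑ f, |blk (F κ y') j k p.1 p.2 g f| * Real.exp (σ * (l1 (p.1 - ((m + 1 : ℕ) : ℤ) • y') + l1 (p.2 - ((m + 1 : ℕ) : ℤ) • y'))))
    (hcF : ∀ (κ : Fin (3 + 1)) (y' : Fin (3 + 1) → ℤ) (j k : Bool),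
      (∑ b ∈ box (3 + 1) (m + 1), |c κ (((m + 1 : ℕ) : ℤ) • y' + toSite b)|)
        * (∑' p : Site 4 × Site 4, ∑ g, ∑ f, |blk (F κ y') j k p.1 p.2 g f|
          * Real.exp (σ * (l1 (p.1 - ((m + 1 : ℕ) : ℤ) • y') + l1 (p.2 - ((m + 1 : ℕ) : ℤ) • y'))))
        ≤ ((m + 1 : ℕ) : ℝ) ^ 4 * mS j k)
    (μ : Fin (3 + 1)) (y : Fin (3 + 1) → ℤ) (j k : Bool) :
    (Summable fun p : Site 4 × Site 4 => ∑ g, ∑ f,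
        |blk (vertexOfK (coDressKBmAt (toSite r) (m + 1) (KInvStep (d := 3) (m + 1) 0)) (m + 1) S' μ y) j k p.1 p.2 g f|
          * Real.exp (σ * (l1 (p.1 - ((m + 1 : ℕ) : ℤ) • y) + l1 (p.2 - ((m + 1 : ℕ) : ℤ) • y)))) ∧
      ∑' p : Site 4 × Site 4, ∑ g, ∑ f,
          |blk (vertexOfK (coDressKBmAt (toSite r) (m + 1) (KInvStep (d := 3) (m + 1) 0)) (m + 1) S' μ y) j k p.1 p.2 g f|
            * Real.exp (σ * (l1 (p.1 - ((m + 1 : ℕ) : ℤ) • y) + l1 (p.2 - ((m + 1 : ℕ) : ℤ) • y)))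
        ≤ 4 * ((MG163 4 * periodConst (kappa163 4) 3) * (1 + 8 * (1 + Real.exp (kappa163 4 / 4))) * Real.exp (kappa163 4 / 4))
            * Real.exp (kappa163 4 / 4 / 2) * Zl 4 (kappa163 4 / 4 / 8) * (Real.exp (kappa163 4 / 4 / 2) * mS j k) := by
  have hn1 : 1 ≤ m + 1 := Nat.succ_le_succ (Nat.zero_le m)
  have hn0 : (0 : ℝ) < ((m + 1 : ℕ) : ℝ) := by exact_mod_cast Nat.succ_pos m
  -- the block families `u ↦ blk (S′ κ u) j k` are block-indexed with the same weights and the block tables `blk (F κ y′) j k`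
  have hT : ∀ (κ : Fin (3 + 1)) (j k : Bool) (y' : Fin (3 + 1) → ℤ), ∀ b ∈ box (3 + 1) (m + 1),
      (fun u => blk (S' κ u) j k) (((m + 1 : ℕ) : ℤ) • y' + toSite b) = c κ (((m + 1 : ℕ) : ℤ) • y' + toSite b) • blk (F κ y') j k := by
    intro κ j k y' b hb
    show blk (S' κ (((m + 1 : ℕ) : ℤ) • y' + toSite b)) j k = _
    rw [hS' κ y' b hb, blk_smul']
  -- the in-block recentring cost `e^{2σ·4·n} ≤ e^{κ′∕2}`
  have hrec : Real.exp (2 * σ * ((((3 + 1 : ℕ) : ℕ) : ℝ) * (((m + 1 : ℕ) : ℕ) : ℝ))) ≤ Real.exp (kappa163 4 / 4 / 2) := by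
    refine Real.exp_le_exp.2 ?_
    have e4 : ((((3 + 1 : ℕ) : ℕ) : ℝ)) = 4 := by norm_num
    rw [e4]
    have h16 : σ * (16 * ((m + 1 : ℕ) : ℝ)) ≤ kappa163 4 / 4 := (le_div_iff₀ (by positivity)).1 hσ
    push_cast at h16 ⊢
    nlinarith [h16, hσ0, hn0]
  -- per-slot summability (§1) and the factorised block totals (§1) against the product letter
  have hSs : ∀ κ u j k, Summable fun p : Site 4 × Site 4 =>
      ∑ g, ∑ f, |blk (S' κ u) j k p.1 p.2 g f| * Real.exp (σ * (l1 (p.1 - u) + l1 (p.2 - u))) := fun κ u j k =>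
    mass_blockIndexed_slot_summable (T := fun u => blk (S' κ u) j k) (c := c κ) (Fb := fun y' => blk (F κ y') j k) hn1 hσ0
      (hT κ j k) (fun y' => hFs κ y' j k) u
  have hSB : ∀ (κ : Fin (3 + 1)) (y' : Fin (3 + 1) → ℤ) (j k : Bool), ∑ b ∈ box (3 + 1) (m + 1),
      (∑' p : Site 4 × Site 4, ∑ g, ∑ f, |blk (S' κ (((m + 1 : ℕ) : ℤ) • y' + toSite b)) j k p.1 p.2 g f|
        * Real.exp (σ * (l1 (p.1 - (((m + 1 : ℕ) : ℤ) • y' + toSite b)) + l1 (p.2 - (((m + 1 : ℕ) : ℤ) • y' + toSite b)))))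
      ≤ ((m + 1 : ℕ) : ℝ) ^ 4 * (Real.exp (kappa163 4 / 4 / 2) * mS j k) := by
    intro κ y' j k
    have h1 := (blockTotal_le_of_blockIndexed (T := fun u => blk (S' κ u) j k) (c := c κ) (Fy := blk (F κ y') j k) hσ0 y'
      (hT κ j k y') (hFs κ y' j k)).2
    set L : ℝ := ∑ b ∈ box (3 + 1) (m + 1), |c κ (((m + 1 : ℕ) : ℤ) • y' + toSite b)| with hL
    set M : ℝ := ∑' p : Site 4 × Site 4, ∑ g, ∑ f, |blk (F κ y') j k p.1 p.2 g f|
      * Real.exp (σ * (l1 (p.1 - ((m + 1 : ℕ) : ℤ) • y') + l1 (p.2 - ((m + 1 : ℕ) : ℤ) • y'))) with hM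
    have hL0 : 0 ≤ L := Finset.sum_nonneg fun b _ => abs_nonneg _
    have hM0 : 0 ≤ M := tsum_nonneg fun p => Finset.sum_nonneg fun g _ => Finset.sum_nonneg fun f _ => by positivity
    have hLM : L * M ≤ ((m + 1 : ℕ) : ℝ) ^ 4 * mS j k := hcF κ y' j k
    refine h1.trans ((mul_le_mul_of_nonneg_right (mul_le_mul_of_nonneg_left hrec hL0) hM0).trans ?_)
    nlinarith [hLM, Real.exp_pos (kappa163 4 / 4 / 2)]
  exact mass_blk_vertexOfK_G₀_le_of_blockTotal m hr hσ0 hσ hSs hSB μ y j k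

/-- [folklore] **«FACE-PACK» FROM THE TWO COUNTS DISPLAYED SEPARATELY**: the weights' block-ℓ¹ law `Σ_{b ∈ box 4 n} |c κ (n•y′ + b)| ≤ n·cW` (`0 ≤ cW`; N-g22-1:
`≈ (D∕4)·n`) and a face-type block-table mass `≤ n³·m̄F j k` (§4) give the product letter with `m̄ := cW·m̄F`; other normalisations re-enter through the previous theorem. -/
theorem mass_blk_vertexOfK_G₀_le_of_blockIndexed_split {S' : Fin (3 + 1) → (Fin (3 + 1) → ℤ) → MKer 4 (Fib 3)}
    {c : Fin (3 + 1) → (Fin (3 + 1) → ℤ) → ℝ} {F : Fin (3 + 1) → (Fin (3 + 1) → ℤ) → MKer 4 (Fib 3)} {σ cW : ℝ} {mF : Bool → Bool → ℝ}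
    (hσ0 : 0 ≤ σ) (hσ : σ ≤ kappa163 4 / 4 / (16 * ((m + 1 : ℕ) : ℝ))) (hcW : 0 ≤ cW)
    (hS' : ∀ (κ : Fin (3 + 1)) (y' : Fin (3 + 1) → ℤ), ∀ b ∈ box (3 + 1) (m + 1),
      S' κ (((m + 1 : ℕ) : ℤ) • y' + toSite b) = c κ (((m + 1 : ℕ) : ℤ) • y' + toSite b) • F κ y')
    (hcB : ∀ (κ : Fin (3 + 1)) (y' : Fin (3 + 1) → ℤ),
      ∑ b ∈ box (3 + 1) (m + 1), |c κ (((m + 1 : ℕ) : ℤ) • y' + toSite b)| ≤ ((m + 1 : ℕ) : ℝ) * cW)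
    (hFs : ∀ (κ : Fin (3 + 1)) (y' : Fin (3 + 1) → ℤ) (j k : Bool), Summable fun p : Site 4 × Site 4 =>
      ∑ g, ∑ f, |blk (F κ y') j k p.1 p.2 g f| * Real.exp (σ * (l1 (p.1 - ((m + 1 : ℕ) : ℤ) • y') + l1 (p.2 - ((m + 1 : ℕ) : ℤ) • y'))))
    (hFm : ∀ (κ : Fin (3 + 1)) (y' : Fin (3 + 1) → ℤ) (j k : Bool),
      ∑' p : Site 4 × Site 4, ∑ g, ∑ f, |blk (F κ y') j k p.1 p.2 g f|
          * Real.exp (σ * (l1 (p.1 - ((m + 1 : ℕ) : ℤ) • y') + l1 (p.2 - ((m + 1 : ℕ) : ℤ) • y')))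
        ≤ ((m + 1 : ℕ) : ℝ) ^ 3 * mF j k)
    (μ : Fin (3 + 1)) (y : Fin (3 + 1) → ℤ) (j k : Bool) :
    (Summable fun p : Site 4 × Site 4 => ∑ g, ∑ f,
        |blk (vertexOfK (coDressKBmAt (toSite r) (m + 1) (KInvStep (d := 3) (m + 1) 0)) (m + 1) S' μ y) j k p.1 p.2 g f|
          * Real.exp (σ * (l1 (p.1 - ((m + 1 : ℕ) : ℤ) • y) + l1 (p.2 - ((m + 1 : ℕ) : ℤ) • y)))) ∧
      ∑' p : Site 4 × Site 4, ∑ g, ∑ f,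
          |blk (vertexOfK (coDressKBmAt (toSite r) (m + 1) (KInvStep (d := 3) (m + 1) 0)) (m + 1) S' μ y) j k p.1 p.2 g f|
            * Real.exp (σ * (l1 (p.1 - ((m + 1 : ℕ) : ℤ) • y) + l1 (p.2 - ((m + 1 : ℕ) : ℤ) • y)))
        ≤ 4 * ((MG163 4 * periodConst (kappa163 4) 3) * (1 + 8 * (1 + Real.exp (kappa163 4 / 4))) * Real.exp (kappa163 4 / 4))
            * Real.exp (kappa163 4 / 4 / 2) * Zl 4 (kappa163 4 / 4 / 8) * (Real.exp (kappa163 4 / 4 / 2) * (cW * mF j k)) := by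
  have hn0 : (0 : ℝ) < ((m + 1 : ℕ) : ℝ) := by exact_mod_cast Nat.succ_pos m
  -- the product letter: `(n·cW)·(n³·m̄F) = n⁴·(cW·m̄F)`
  have hcF : ∀ (κ : Fin (3 + 1)) (y' : Fin (3 + 1) → ℤ) (j k : Bool),
      (∑ b ∈ box (3 + 1) (m + 1), |c κ (((m + 1 : ℕ) : ℤ) • y' + toSite b)|)
        * (∑' p : Site 4 × Site 4, ∑ g, ∑ f, |blk (F κ y') j k p.1 p.2 g f|
          * Real.exp (σ * (l1 (p.1 - ((m + 1 : ℕ) : ℤ) • y') + l1 (p.2 - ((m + 1 : ℕ) : ℤ) • y'))))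
        ≤ ((m + 1 : ℕ) : ℝ) ^ 4 * (cW * mF j k) := by
    intro κ y' j k
    have hM0 : 0 ≤ ∑' p : Site 4 × Site 4, ∑ g, ∑ f, |blk (F κ y') j k p.1 p.2 g f|
        * Real.exp (σ * (l1 (p.1 - ((m + 1 : ℕ) : ℤ) • y') + l1 (p.2 - ((m + 1 : ℕ) : ℤ) • y'))) :=
      tsum_nonneg fun p => Finset.sum_nonneg fun g _ => Finset.sum_nonneg fun f _ => by positivity
    exact (mul_le_mul (hcB κ y') (hFm κ y' j k) hM0 (by positivity)).trans (le_of_eq (by ring))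
  exact mass_blk_vertexOfK_G₀_le_of_blockIndexed m hr hσ0 hσ hS' hFs hcF μ y j k

end Packed

/-! ## §3 The consumer shapes: any block size `[NeZero N]`; the scales `Lc^k`, `k ≥ 1`, in 17-M♭'s `hPs ∕ hPm` binder shape -/

/-- [folklore] **«FACE-PACK» AT ANY BLOCK SIZE `[NeZero N]`** — §2 re-indexed on `N` (the `N = M + 1` device of `PackedColumnBlockTotalScales`). -/
theorem mass_blk_vertexOfK_G₀_le_of_blockIndexed_at (N : ℕ) [NeZero N] {r : Fin (3 + 1) → ℕ} (hr : r ∈ box (3 + 1) N)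
    {S' : Fin (3 + 1) → (Fin (3 + 1) → ℤ) → MKer 4 (Fib 3)}
    {c : Fin (3 + 1) → (Fin (3 + 1) → ℤ) → ℝ} {F : Fin (3 + 1) → (Fin (3 + 1) → ℤ) → MKer 4 (Fib 3)} {σ : ℝ} {mS : Bool → Bool → ℝ}
    (hσ0 : 0 ≤ σ) (hσ : σ ≤ kappa163 4 / 4 / (16 * ((N : ℕ) : ℝ)))
    (hS' : ∀ (κ : Fin (3 + 1)) (y' : Fin (3 + 1) → ℤ), ∀ b ∈ box (3 + 1) N,
      S' κ (((N : ℕ) : ℤ) • y' + toSite b) = c κ (((N : ℕ) : ℤ) • y' + toSite b) • F κ y')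
    (hFs : ∀ (κ : Fin (3 + 1)) (y' : Fin (3 + 1) → ℤ) (j k : Bool), Summable fun p : Site 4 × Site 4 =>
      ∑ g, ∑ f, |blk (F κ y') j k p.1 p.2 g f| * Real.exp (σ * (l1 (p.1 - ((N : ℕ) : ℤ) • y') + l1 (p.2 - ((N : ℕ) : ℤ) • y'))))
    (hcF : ∀ (κ : Fin (3 + 1)) (y' : Fin (3 + 1) → ℤ) (j k : Bool),
      (∑ b ∈ box (3 + 1) N, |c κ (((N : ℕ) : ℤ) • y' + toSite b)|)
        * (∑' p : Site 4 × Site 4, ∑ g, ∑ f, |blk (F κ y') j k p.1 p.2 g f|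
          * Real.exp (σ * (l1 (p.1 - ((N : ℕ) : ℤ) • y') + l1 (p.2 - ((N : ℕ) : ℤ) • y'))))
        ≤ ((N : ℕ) : ℝ) ^ 4 * mS j k)
    (μ : Fin (3 + 1)) (y : Fin (3 + 1) → ℤ) (j k : Bool) :
    (Summable fun p : Site 4 × Site 4 => ∑ g, ∑ f,
        |blk (vertexOfK (coDressKBmAt (toSite r) N (KInvStep (d := 3) N 0)) N S' μ y) j k p.1 p.2 g f|
          * Real.exp (σ * (l1 (p.1 - ((N : ℕ) : ℤ) • y) + l1 (p.2 - ((N : ℕ) : ℤ) • y)))) ∧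
      ∑' p : Site 4 × Site 4, ∑ g, ∑ f,
          |blk (vertexOfK (coDressKBmAt (toSite r) N (KInvStep (d := 3) N 0)) N S' μ y) j k p.1 p.2 g f|
            * Real.exp (σ * (l1 (p.1 - ((N : ℕ) : ℤ) • y) + l1 (p.2 - ((N : ℕ) : ℤ) • y)))
        ≤ 4 * ((MG163 4 * periodConst (kappa163 4) 3) * (1 + 8 * (1 + Real.exp (kappa163 4 / 4))) * Real.exp (kappa163 4 / 4))
            * Real.exp (kappa163 4 / 4 / 2) * Zl 4 (kappa163 4 / 4 / 8) * (Real.exp (kappa163 4 / 4 / 2) * mS j k) := by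
  obtain ⟨M, rfl⟩ : ∃ M, N = M + 1 := ⟨N - 1, (Nat.succ_pred_eq_of_ne_zero (NeZero.ne N)).symm⟩
  exact mass_blk_vertexOfK_G₀_le_of_blockIndexed M hr hσ0 hσ hS' hFs hcF μ y j k

/-- [folklore] **«FACE-PACK» ON THE SCALES `N = Lc^k`, `k ≥ 1`, ALL FOUR BLOCKS PACKED**: per-scale roots, block-indexed families `S′ n` (weights `c n`, block tables
`F n`), one rate `0 ≤ σP ≤ κ′∕16`, base-centred summability and the PRODUCT letters at rate `σP∕Lc^k` at every scale: summability and the packed rows of every block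
`(j, k′)` of `vertexOfK (G₀^{bm} (r (Lc^k))) (Lc^k) (S′ (Lc^k)) ρ y` with `mP j k′ := 4·C_{G₀}·e^{κ′∕2}·Zl 4 (κ′∕8)·(e^{κ′∕2}·m̄ j k′)` — `PackedRoadRowsMassFlat.jet_letters_mass_flat`'s
`hPs ∕ hPm` shape WITHOUT the guard `j ≠ k′` (a contact family has no per-slot k-free block; the guarded binders are these conjuncts with the premise discarded). -/
theorem hP_of_blockIndexed_scales {Lc : ℕ} [NeZero Lc] {r : ℕ → Fin (3 + 1) → ℕ} (hr : ∀ m : ℕ, r (m + 1) ∈ box (3 + 1) (m + 1))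
    {S' : ℕ → Fin 4 → (Fin 4 → ℤ) → MKer 4 (Fib 3)} {c : ℕ → Fin 4 → (Fin 4 → ℤ) → ℝ} {F : ℕ → Fin 4 → (Fin 4 → ℤ) → MKer 4 (Fib 3)}
    {σP : ℝ} (hσP0 : 0 ≤ σP) (hσPκ : σP ≤ kappa163 4 / 4 / 16) {mS : Bool → Bool → ℝ}
    (hS' : ∀ (k : ℕ), 1 ≤ k → ∀ (κ : Fin 4) (y' : Fin 4 → ℤ), ∀ b ∈ box (3 + 1) (Lc ^ k),
      S' (Lc ^ k) κ (((Lc ^ k : ℕ) : ℤ) • y' + toSite b) = c (Lc ^ k) κ (((Lc ^ k : ℕ) : ℤ) • y' + toSite b) • F (Lc ^ k) κ y')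
    (hFs : ∀ (k : ℕ), 1 ≤ k → ∀ (κ : Fin 4) (y' : Fin 4 → ℤ) (j k' : Bool), Summable fun p : Site 4 × Site 4 =>
      ∑ g, ∑ f, |blk (F (Lc ^ k) κ y') j k' p.1 p.2 g f|
        * Real.exp (σP / ((Lc ^ k : ℕ) : ℝ) * (l1 (p.1 - ((Lc ^ k : ℕ) : ℤ) • y') + l1 (p.2 - ((Lc ^ k : ℕ) : ℤ) • y'))))
    (hcF : ∀ (k : ℕ), 1 ≤ k → ∀ (κ : Fin 4) (y' : Fin 4 → ℤ) (j k' : Bool),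
      (∑ b ∈ box (3 + 1) (Lc ^ k), |c (Lc ^ k) κ (((Lc ^ k : ℕ) : ℤ) • y' + toSite b)|)
        * (∑' p : Site 4 × Site 4, ∑ g, ∑ f, |blk (F (Lc ^ k) κ y') j k' p.1 p.2 g f|
          * Real.exp (σP / ((Lc ^ k : ℕ) : ℝ) * (l1 (p.1 - ((Lc ^ k : ℕ) : ℤ) • y') + l1 (p.2 - ((Lc ^ k : ℕ) : ℤ) • y'))))
        ≤ ((Lc ^ k : ℕ) : ℝ) ^ 4 * mS j k') :
    (∀ (k : ℕ), 1 ≤ k → ∀ (ρ : Fin 4) (y : Site 4) (j k' : Bool), Summable fun p : Site 4 × Site 4 => ∑ g, ∑ f,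
      |blk (vertexOfK (coDressKBmAt (toSite (r (Lc ^ k))) (Lc ^ k) (KInvStep (d := 3) (Lc ^ k) 0)) (Lc ^ k) (S' (Lc ^ k)) ρ y) j k' p.1 p.2 g f|
        * Real.exp (σP / ((Lc ^ k : ℕ) : ℝ) * (l1 (p.1 - ((Lc ^ k : ℕ) : ℤ) • y) + l1 (p.2 - ((Lc ^ k : ℕ) : ℤ) • y)))) ∧
    (∀ (k : ℕ), 1 ≤ k → ∀ (ρ : Fin 4) (y : Site 4) (j k' : Bool), ∑' p : Site 4 × Site 4, ∑ g, ∑ f,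
      |blk (vertexOfK (coDressKBmAt (toSite (r (Lc ^ k))) (Lc ^ k) (KInvStep (d := 3) (Lc ^ k) 0)) (Lc ^ k) (S' (Lc ^ k)) ρ y) j k' p.1 p.2 g f|
        * Real.exp (σP / ((Lc ^ k : ℕ) : ℝ) * (l1 (p.1 - ((Lc ^ k : ℕ) : ℤ) • y) + l1 (p.2 - ((Lc ^ k : ℕ) : ℤ) • y)))
      ≤ 4 * ((MG163 4 * periodConst (kappa163 4) 3) * (1 + 8 * (1 + Real.exp (kappa163 4 / 4))) * Real.exp (kappa163 4 / 4))
          * Real.exp (kappa163 4 / 4 / 2) * Zl 4 (kappa163 4 / 4 / 8) * (Real.exp (kappa163 4 / 4 / 2) * mS j k')) := by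
  -- one scale at a time: the root is in the block, the rate window `0 ≤ σP∕n ≤ κ′∕(16n)`
  have key : ∀ (k : ℕ), 1 ≤ k → r (Lc ^ k) ∈ box (3 + 1) (Lc ^ k) ∧ 0 ≤ σP / ((Lc ^ k : ℕ) : ℝ) ∧
      σP / ((Lc ^ k : ℕ) : ℝ) ≤ kappa163 4 / 4 / (16 * ((Lc ^ k : ℕ) : ℝ)) := by
    intro k hk
    have hn0 : (0 : ℝ) < ((Lc ^ k : ℕ) : ℝ) := by
      exact_mod_cast Nat.pos_of_ne_zero (pow_ne_zero k (NeZero.ne Lc))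
    have hrk : r (Lc ^ k) ∈ box (3 + 1) (Lc ^ k) := by
      have h := hr (Lc ^ k - 1)
      rwa [Nat.sub_add_cancel (Nat.one_le_pow _ _ (Nat.pos_of_ne_zero (NeZero.ne Lc)))] at h
    refine ⟨hrk, div_nonneg hσP0 hn0.le, ?_⟩
    rw [← div_div]
    exact div_le_div_of_nonneg_right hσPκ hn0.le
  exact ⟨fun k hk1 ρ y j k' => (mass_blk_vertexOfK_G₀_le_of_blockIndexed_at (Lc ^ k) (key k hk1).1 (key k hk1).2.1
      (key k hk1).2.2 (hS' k hk1) (hFs k hk1) (hcF k hk1) ρ y j k').1,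
    fun k hk1 ρ y j k' => (mass_blk_vertexOfK_G₀_le_of_blockIndexed_at (Lc ^ k) (key k hk1).1 (key k hk1).2.1
      (key k hk1).2.2 (hS' k hk1) (hFs k hk1) (hcF k hk1) ρ y j k').2⟩

/-! ## §4 Generic: the mass of a finite signed combination of tables, recentred to one centre (the face sum's mass from the face total) -/

section Combination
variable {D : ℕ} {F : Type*} [Fintype F]

/-- [folklore] **THE MASS OF A FINITE SIGNED COMBINATION OF KERNELS, RECENTRED** (GENERIC): for `0 ≤ σ`, kernels `K s` (`s ∈ Φ`) with summable `(q s)`-centred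
`σ`-masses `≤ ρ s`, centres within `|q s − c|₁ ≤ R`: `Σ_{s ∈ Φ} a s • K s` has summable `c`-centred `σ`-mass `≤ e^{2σR}·Σ_{s ∈ Φ} |a s|·ρ s`. -/
theorem mass_finset_sum_smul_recentre_le {ι : Type*} (Φ : Finset ι) {a : ι → ℝ} {K : ι → MKer D F} {q : ι → Site D} {ρ : ι → ℝ}
    {σ R : ℝ} (hσ : 0 ≤ σ) (c : Site D)
    (hKs : ∀ s ∈ Φ, Summable fun p : Site D × Site D => ∑ x, ∑ b, |K s p.1 p.2 x b| * Real.exp (σ * (l1 (p.1 - q s) + l1 (p.2 - q s))))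
    (hKm : ∀ s ∈ Φ, ∑' p : Site D × Site D, ∑ x, ∑ b, |K s p.1 p.2 x b| * Real.exp (σ * (l1 (p.1 - q s) + l1 (p.2 - q s))) ≤ ρ s)
    (hR : ∀ s ∈ Φ, l1 (q s - c) ≤ R) :
    (Summable fun p : Site D × Site D => ∑ x, ∑ b, |(∑ s ∈ Φ, a s • K s) p.1 p.2 x b| * Real.exp (σ * (l1 (p.1 - c) + l1 (p.2 - c)))) ∧
      ∑' p : Site D × Site D, ∑ x, ∑ b, |(∑ s ∈ Φ, a s • K s) p.1 p.2 x b| * Real.exp (σ * (l1 (p.1 - c) + l1 (p.2 - c)))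
        ≤ Real.exp (2 * σ * R) * ∑ s ∈ Φ, |a s| * ρ s := by
  -- per term: recentre, then scale
  have hterm : ∀ s ∈ Φ,
      (Summable fun p : Site D × Site D => ∑ x, ∑ b, |(a s • K s) p.1 p.2 x b| * Real.exp (σ * (l1 (p.1 - c) + l1 (p.2 - c)))) ∧
      ∑' p : Site D × Site D, ∑ x, ∑ b, |(a s • K s) p.1 p.2 x b| * Real.exp (σ * (l1 (p.1 - c) + l1 (p.2 - c)))
        ≤ |a s| * (ρ s * Real.exp (2 * σ * R)) := by
    intro s hs
    obtain ⟨h1, h2⟩ := stencil_mass_recentre (K := K s) hσ (q s) c (hKs s hs) (hKm s hs)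
    have hρ0 : 0 ≤ ρ s := (tsum_nonneg fun p => Finset.sum_nonneg fun x _ => Finset.sum_nonneg fun b _ => by positivity).trans (hKm s hs)
    have h3 : ∑' p : Site D × Site D, ∑ x, ∑ b, |K s p.1 p.2 x b| * Real.exp (σ * (l1 (p.1 - c) + l1 (p.2 - c)))
        ≤ ρ s * Real.exp (2 * σ * R) :=
      h2.trans (mul_le_mul_of_nonneg_left (Real.exp_le_exp.2 (by nlinarith [hR s hs, hσ])) hρ0)
    exact mass_smul_le (W := fun p : Site D × Site D => Real.exp (σ * (l1 (p.1 - c) + l1 (p.2 - c)))) h1 h3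
  obtain ⟨hs, hb⟩ := mass_finset_sum_le Φ (K := fun s => a s • K s)
    (W := fun p : Site D × Site D => Real.exp (σ * (l1 (p.1 - c) + l1 (p.2 - c)))) (m := fun s => |a s| * (ρ s * Real.exp (2 * σ * R)))
    (fun p => (Real.exp_pos _).le) (fun s hs => (hterm s hs).1) (fun s hs => (hterm s hs).2)
  refine ⟨hs, hb.trans (le_of_eq ?_)⟩
  rw [Finset.mul_sum]
  exact Finset.sum_congr rfl fun s _ => by ring

/-- [our object] The blocks of a finite signed combination of packed tables (definitional). -/
theorem blk_finset_sum_smul {ι : Type*} (Φ : Finset ι) (a : ι → ℝ) (K : ι → MKer 4 (Fib 3)) (j k : Bool) :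
    blk (∑ s ∈ Φ, a s • K s) j k = ∑ s ∈ Φ, a s • blk (K s) j k := by
  funext x z g f
  simp only [PackedKernelSplit.blk, Finset.sum_apply, Pi.smul_apply, smul_eq_mul]

/-- [folklore] **THE BLOCK MASSES OF A FINITE SIGNED COMBINATION OF PACKED TABLES, RECENTRED** (`d = 3`; ANY index type — product-indexed slot sets
`Fin 4 × Site 4` and leaf-03's sigma-indexed `univ.sigma (bondNbhd n Y)` alike): tables `T s` (`s ∈ Φ`) with block letters `≤ ρ s j k` at their own centres
`q s`, all within `|q s − c|₁ ≤ R` ⟹ every block of `Σ_{s ∈ Φ} a s • T s` has summable `c`-centred mass `≤ e^{2σR}·Σ_{s ∈ Φ} |a s|·ρ s j k` — the block table's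
mass input of §2 from the FACE TOTAL of the raw tables' letters (for the face sum: `T s := S s.1 s.2`, `q s := s.2`, `a s := gaugeWt ∈ {0, ±1}`). -/
theorem mass_blk_finset_sum_smul_recentre_le {ι : Type*} (Φ : Finset ι) {a : ι → ℝ} {T : ι → MKer 4 (Fib 3)} {q : ι → Fin (3 + 1) → ℤ}
    {ρ : ι → Bool → Bool → ℝ} {σ R : ℝ} (hσ : 0 ≤ σ) (c : Fin (3 + 1) → ℤ)
    (hSs : ∀ s ∈ Φ, ∀ j k, Summable fun p : Site 4 × Site 4 =>
      ∑ g, ∑ f, |blk (T s) j k p.1 p.2 g f| * Real.exp (σ * (l1 (p.1 - q s) + l1 (p.2 - q s))))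
    (hSm : ∀ s ∈ Φ, ∀ j k, ∑' p : Site 4 × Site 4,
      ∑ g, ∑ f, |blk (T s) j k p.1 p.2 g f| * Real.exp (σ * (l1 (p.1 - q s) + l1 (p.2 - q s))) ≤ ρ s j k)
    (hR : ∀ s ∈ Φ, l1 (q s - c) ≤ R) (j k : Bool) :
    (Summable fun p : Site 4 × Site 4 => ∑ g, ∑ f,
        |blk (∑ s ∈ Φ, a s • T s) j k p.1 p.2 g f| * Real.exp (σ * (l1 (p.1 - c) + l1 (p.2 - c)))) ∧
      ∑' p : Site 4 × Site 4, ∑ g, ∑ f,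
          |blk (∑ s ∈ Φ, a s • T s) j k p.1 p.2 g f| * Real.exp (σ * (l1 (p.1 - c) + l1 (p.2 - c)))
        ≤ Real.exp (2 * σ * R) * ∑ s ∈ Φ, |a s| * ρ s j k := by
  rw [blk_finset_sum_smul]
  exact mass_finset_sum_smul_recentre_le Φ (K := fun s => blk (T s) j k) (q := q) (ρ := fun s => ρ s j k) hσ c
    (fun s hs => hSs s hs j k) (fun s hs => hSm s hs j k) hR

end Combination

end Summit.QuantumFields.BalabanUV.Beta.D1BFx.PackedColumnBlockIndexedMass

end
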